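import Mathlib
import HarnessLib
import Summits.Ventures.LatticeQCDFlow.Exactness.SphereLOFlowLogJacobianStability
import Summits.Ventures.LatticeQCDFlow.Exactness.SphereLOFlowEffectiveActionTails

/-!
# Self-averaging under the flowed law: an `ℓ¹`-Lipschitz observable composed with the exact leading-order flow has bounded differences `2L·e^{Kc}`, variance `≤ |Λ|·L²e^{2Kc}` and sub-Gaussian tails — the action of a flow sample fluctuates like `√|Λ|`

HONEST FRAMING: exact (Metropolis-corrected) sampling algorithms for lattice gauge theory;
figures of merit are autocorrelation/cost numbers at stated couplings and volumes; no
continuum-physics claim.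

Venture `LatticeQCDFlow` (cell pub-lqcd), topic `Exactness`; FANOUT row 7 (`s0-cpn-null`: the
S0-D1 rung — 2D CP⁹, Lüscher's LO trivializing map inside HMC, Engel–Schaefer 2011).  NEW WORK of
the cell over this leg's `Exactness/SphereLOFlowL1Stability.lean` (`ℓ¹`-stability of the exact LO
flow, rate `K = 3|κ|υ/(d−1)`), `Exactness/SphereLOFlowLogJacobianStability.lean` (the E–S action is
`ℓ¹`-Lipschitz on `Ω̃` with constant `2|κ|υ`), `Exactness/LatticeBoundedDifferences.lean` and
`Exactness/SphereLOFlowEffectiveActionTails.lean` (Efron–Stein–Popoviciu variance bound, McDiarmid's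
tail form for bounded-difference functionals of the product law); nothing is cited as a fact.
Printed counterpart, NAMED ONLY: C. McDiarmid 1989 Lemma (1.2); the "self-averaging of local
observables in flow samples" heuristics of the flow-sampling literature (Albergo–Kanwar–Shanahan
2019 §II) are not relied upon.

## Setting

`π̄ = ⊗_Λ σ̄` on `Ω = S(E)^Λ`; the exact LO flow `Φ_{0→c}` of the E–S action (`d ≥ 2`, no
self-coupling, adjoint pairs, local weight `Σ_m‖U_km‖ ≤ υ`), `K = 3|κ|υ/(d−1)`; an observable
`O : (Λ → E) → ℝ`, continuous, `ℓ¹`-LIPSCHITZ ON `Ω̃`: `|O(x) − O(y)| ≤ L·Σ_j‖x_j − y_j‖` (every sum of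
local terms with uniformly Lipschitz densities is such, with `L` independent of `|Λ|`; the action
has `L = 2|κ|υ`).  THE FLOWED OBSERVABLE `O∘Φ_{0→c}` is the observable measured on a flow sample.

## Content

* **`flowedObs_bddDiff`** — `O∘Φ_{0→c}` has bounded differences `2L·e^{Kc}` on `Ω` (every site,
  every volume); `continuous_flowedObs`.
* **`variance_flowedObs_le`** — `Var_π̄(O∘Φ_{0→c}) ≤ |Λ|·(2Le^{Kc})²/4 = |Λ|·L²e^{2Kc}`: PER SITE,
  `Var_π̄(O∘Φ_{0→c}/|Λ|) ≤ L²e^{2Kc}/|Λ| → 0` — SELF-AVERAGING of `ℓ¹`-Lipschitz observables under the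
  flowed law, uniformly in the coupling geometry.
* **`measureReal_flowedObs_ge_le`** — the sub-Gaussian tail
  `π̄{O∘Φ_{0→c} − E ≥ r} ≤ exp(−2r²/(|Λ|·(2Le^{Kc})²))`.
* **`variance_action_comp_loFlow_le`**, **`measureReal_action_comp_loFlow_ge_le`** — THE ACTION OF
  A FLOW SAMPLE: `Var_π̄(S∘Φ_{0→c}) ≤ |Λ|·(4|κ|υe^{Kc})²/4`, tails `exp(−2r²/(|Λ|(4|κ|υe^{Kc})²))`:
  the action of an exactly LO-flowed uniform configuration is within `O(√|Λ|)` of its mean.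

NOT CLAIMED: lower bounds; central limit theorems; anything about the target (Gibbs) law itself
(that needs the acceptance / reweighting step); the one-step map of the rung; numbers.
-/

noncomputable section

namespace Summit.Ventures.LatticeQCDFlow.Exactness

open Function Set Metric MeasureTheory NormedSpace InnerProductSpace
open scoped RealInnerProductSpace Topology

variable {Λ : Type*} {E : Type*} [NormedAddCommGroup E] [InnerProductSpace ℝ E]
  [FiniteDimensional ℝ E] [Fintype Λ] [DecidableEq Λ] [MeasurableSpace E] [BorelSpace E] [Nontrivial E]
  {U : Λ → Λ → (E →L[ℝ] E)} {T : ℝ}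

/-! ## §1 Flowed `ℓ¹`-Lipschitz observables: bounded differences, variance, tails -/

section Flowed

omit [MeasurableSpace E] [BorelSpace E] [Nontrivial E] in
/-- The flowed observable is continuous on `Ω`. -/
theorem continuous_flowedObs (κ S₀ c : ℝ) {O : (Λ → E) → ℝ} (hO : Continuous O) :
    Continuous fun ω : Λ → sphere (0 : E) 1 =>
      O (sphereTDFlow (G := fun _ : ℝ => loFlowAction κ S₀ U)
        (contDiff_const_family (contDiff_loFlowAction U κ S₀)) T 0 c (fun m => (ω m : E))) :=
  hO.comp ((contDiff_sphereTDFlow_apply (G := fun _ : ℝ => loFlowAction κ S₀ U)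
    (contDiff_const_family (contDiff_loFlowAction U κ S₀)) 0 c (T := T)).continuous.comp
      continuous_sphereConfig)

omit [MeasurableSpace E] [BorelSpace E] [Nontrivial E] in
/-- **THE FLOWED OBSERVABLE HAS BOUNDED DIFFERENCES `2L·e^{Kc}`**: for an `ℓ¹`-Lipschitz observable
`O` (constant `L` on `Ω̃`) and `0 ≤ c`, replacing one site of `ω` changes `O(Φ_{0→c}ω)` by at most
`2L·exp((3|κ|υ/(d−1))·c)` — independent of the site and the volume. -/
theorem flowedObs_bddDiff (hU0 : ∀ n, U n n = 0)
    (hUadj : ∀ m n (v w : E), ⟪U m n v, w⟫ = ⟪v, U n m w⟫) (hd : 2 ≤ Module.finrank ℝ E)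
    (κ S₀ : ℝ) {υ : ℝ} (hυ : ∀ k, ∑ m, ‖U k m‖ ≤ υ) {c : ℝ} (hc0 : 0 ≤ c)
    {O : (Λ → E) → ℝ} {L : ℝ}
    (hOL : ∀ x y : Λ → E, (∀ n, ‖x n‖ = 1) → (∀ n, ‖y n‖ = 1) → |O x - O y| ≤ L * ∑ j, ‖x j - y j‖)
    (ω : Λ → sphere (0 : E) 1) (k : Λ) (v v' : sphere (0 : E) 1) :
    O (sphereTDFlow (G := fun _ : ℝ => loFlowAction κ S₀ U)
          (contDiff_const_family (contDiff_loFlowAction U κ S₀)) T 0 c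
            (fun m => ((update ω k v) m : E))) -
      O (sphereTDFlow (G := fun _ : ℝ => loFlowAction κ S₀ U)
          (contDiff_const_family (contDiff_loFlowAction U κ S₀)) T 0 c
            (fun m => ((update ω k v') m : E))) ≤
      2 * L * Real.exp (3 * |κ| * υ / ((Module.finrank ℝ E : ℝ) - 1) * c) := by
  rw [sphereConfig_update, sphereConfig_update]
  set x : Λ → E := update (fun m => (ω m : E)) k (v : E) with hxdef
  have hx : ∀ n, ‖x n‖ = 1 := by
    intro n
    by_cases hn : n = k
    · subst hn; rw [hxdef, update_self]; exact norm_eq_of_mem_sphere v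
    · rw [hxdef, update_of_ne hn]; exact norm_sphereConfig_eq_one ω n
  have hxy : update (fun m => (ω m : E)) k (v' : E) = update x k (v' : E) := by
    rw [hxdef, update_idem]
  rw [hxy]
  have hy : ∀ n, ‖update x k (v' : E) n‖ = 1 := by
    intro n
    by_cases hn : n = k
    · subst hn; rw [update_self]; exact norm_eq_of_mem_sphere v'
    · rw [update_of_ne hn]; exact hx n
  set Φ : (Λ → E) → (Λ → E) := sphereTDFlow (G := fun _ : ℝ => loFlowAction κ S₀ U)
    (contDiff_const_family (contDiff_loFlowAction U κ S₀)) T 0 c with hΦ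
  have hΦx : ∀ n, ‖Φ x n‖ = 1 := fun n => norm_sphereTDFlow_eq_one _ 0 hx c n
  have hΦy : ∀ n, ‖Φ (update x k (v' : E)) n‖ = 1 := fun n => norm_sphereTDFlow_eq_one _ 0 hy c n
  have h1 := hOL _ _ hΦx hΦy
  have h2 := sum_norm_sphereTDFlow_update_sub_le_two (G := fun _ : ℝ => loFlowAction κ S₀ U)
    (contDiff_const_family (contDiff_loFlowAction U κ S₀))
    (fun _ _ _ _ hx' hy' => sum_norm_siteGrad_loFlowAction_sub_le hU0 hUadj hd κ S₀ hυ hx' hy')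
    hx k (norm_eq_of_mem_sphere v') (t₀ := 0) (t₁ := c) (T := T)
  rw [sub_zero, abs_of_nonneg hc0] at h2
  -- if `L < 0`, the hypothesis at `x` and `x` with site `k` flipped is contradictory (`0 ≤ 2L`)
  rcases le_or_gt 0 L with hL | hL
  · calc _ ≤ |O (Φ x) - O (Φ (update x k (v' : E)))| := le_abs_self _
      _ ≤ L * ∑ j, ‖Φ x j - Φ (update x k (v' : E)) j‖ := h1
      _ ≤ L * (2 * Real.exp (3 * |κ| * υ / ((Module.finrank ℝ E : ℝ) - 1) * c)) :=
          mul_le_mul_of_nonneg_left h2 hL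
      _ = _ := by ring
  · exfalso
    rcases isEmpty_or_nonempty Λ with hΛ | hΛ
    · exact (IsEmpty.false k)
    · -- flip site `k` of `x`: `Σ_j ‖x_j − x'_j‖ = ‖x_k + x_k‖ = 2 > 0`
      have hneg : ∀ n, ‖update x k (-(x k)) n‖ = 1 := by
        intro n
        by_cases hn : n = k
        · subst hn; rw [update_self, norm_neg]; exact hx n
        · rw [update_of_ne hn]; exact hx n
      have h := hOL x (update x k (-(x k))) hx hneg
      have hsum : ∑ j, ‖x j - update x k (-(x k)) j‖ = 2 := by
        rw [Finset.sum_eq_single k]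
        · rw [update_self, sub_neg_eq_add, ← two_smul ℝ (x k), norm_smul, Real.norm_eq_abs,
            abs_two, hx k, mul_one]
        · intro j _ hj; rw [update_of_ne hj, sub_self, norm_zero]
        · intro hk; exact absurd (Finset.mem_univ k) hk
      rw [hsum] at h
      have : (0 : ℝ) ≤ L * 2 := le_trans (abs_nonneg _) h
      linarith

end Flowed

/-! ## §2 Variance and tails of flowed observables; the action of a flow sample -/

section Laws

/-- **SELF-AVERAGING UNDER THE FLOWED LAW**: for an `ℓ¹`-Lipschitz observable `O` (constant `L` on
`Ω̃`) and `0 ≤ c`, `Var_π̄(O∘Φ_{0→c}) ≤ |Λ|·(2L·e^{Kc})²/4`, `K = 3|κ|υ/(d−1)` — so the per-site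
observable `O/|Λ|` has variance `≤ L²e^{2Kc}/|Λ|`. -/
theorem variance_flowedObs_le (hU0 : ∀ n, U n n = 0)
    (hUadj : ∀ m n (v w : E), ⟪U m n v, w⟫ = ⟪v, U n m w⟫) (hd : 2 ≤ Module.finrank ℝ E)
    (κ S₀ : ℝ) {υ : ℝ} (hυ : ∀ k, ∑ m, ‖U k m‖ ≤ υ) {c : ℝ} (hc0 : 0 ≤ c)
    {O : (Λ → E) → ℝ} (hO : Continuous O) {L : ℝ}
    (hOL : ∀ x y : Λ → E, (∀ n, ‖x n‖ = 1) → (∀ n, ‖y n‖ = 1) → |O x - O y| ≤ L * ∑ j, ‖x j - y j‖) :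
    ∫ ω, (O (sphereTDFlow (G := fun _ : ℝ => loFlowAction κ S₀ U)
          (contDiff_const_family (contDiff_loFlowAction U κ S₀)) T 0 c
            (fun m => ((ω : Λ → sphere (0 : E) 1) m : E))) -
        ∫ ω', O (sphereTDFlow (G := fun _ : ℝ => loFlowAction κ S₀ U)
          (contDiff_const_family (contDiff_loFlowAction U κ S₀)) T 0 c
            (fun m => ((ω' : Λ → sphere (0 : E) 1) m : E)))
          ∂Measure.pi (fun _ : Λ => uniformSphere (volume : Measure E))) ^ 2
        ∂Measure.pi (fun _ : Λ => uniformSphere (volume : Measure E)) ≤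
      Fintype.card Λ * (2 * L * Real.exp (3 * |κ| * υ / ((Module.finrank ℝ E : ℝ) - 1) * c)) ^ 2 / 4 := by
  have h := variance_le_of_bddDiff (uniformSphere (volume : Measure E))
    (continuous_flowedObs (U := U) κ S₀ c hO (T := T))
    (D := fun _ : Λ => 2 * L * Real.exp (3 * |κ| * υ / ((Module.finrank ℝ E : ℝ) - 1) * c))
    (fun ω k v v' => flowedObs_bddDiff hU0 hUadj hd κ S₀ hυ hc0 hOL ω k v v')
  simp only [Finset.sum_const, Finset.card_univ, nsmul_eq_mul] at h
  exact h

/-- **SUB-GAUSSIAN TAIL OF A FLOWED OBSERVABLE**: for `0 ≤ c`, `r ≥ 0` and `|Λ|·(2Le^{Kc})² > 0`,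
`π̄{O∘Φ_{0→c} − E ≥ r} ≤ exp(−2r²/(|Λ|·(2L·e^{Kc})²))`. -/
theorem measureReal_flowedObs_ge_le (hU0 : ∀ n, U n n = 0)
    (hUadj : ∀ m n (v w : E), ⟪U m n v, w⟫ = ⟪v, U n m w⟫) (hd : 2 ≤ Module.finrank ℝ E)
    (κ S₀ : ℝ) {υ : ℝ} (hυ : ∀ k, ∑ m, ‖U k m‖ ≤ υ) {c : ℝ} (hc0 : 0 ≤ c)
    {O : (Λ → E) → ℝ} (hO : Continuous O) {L : ℝ}
    (hOL : ∀ x y : Λ → E, (∀ n, ‖x n‖ = 1) → (∀ n, ‖y n‖ = 1) → |O x - O y| ≤ L * ∑ j, ‖x j - y j‖)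
    (hpos : 0 < Fintype.card Λ * (2 * L * Real.exp (3 * |κ| * υ / ((Module.finrank ℝ E : ℝ) - 1) * c)) ^ 2)
    {r : ℝ} (hr : 0 ≤ r) :
    (Measure.pi (fun _ : Λ => uniformSphere (volume : Measure E))).real
        {ω : Λ → sphere (0 : E) 1 | r ≤
          O (sphereTDFlow (G := fun _ : ℝ => loFlowAction κ S₀ U)
              (contDiff_const_family (contDiff_loFlowAction U κ S₀)) T 0 c (fun m => (ω m : E))) -
            ∫ ω', O (sphereTDFlow (G := fun _ : ℝ => loFlowAction κ S₀ U)
              (contDiff_const_family (contDiff_loFlowAction U κ S₀)) T 0 c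
                (fun m => ((ω' : Λ → sphere (0 : E) 1) m : E)))
              ∂Measure.pi (fun _ : Λ => uniformSphere (volume : Measure E))} ≤
      Real.exp (-(2 * r ^ 2 / (Fintype.card Λ *
        (2 * L * Real.exp (3 * |κ| * υ / ((Module.finrank ℝ E : ℝ) - 1) * c)) ^ 2))) := by
  have h := measureReal_bddDiff_ge_le (uniformSphere (volume : Measure E))
    (continuous_flowedObs (U := U) κ S₀ c hO (T := T))
    (D := fun _ : Λ => 2 * L * Real.exp (3 * |κ| * υ / ((Module.finrank ℝ E : ℝ) - 1) * c))
    (fun ω k v v' => flowedObs_bddDiff hU0 hUadj hd κ S₀ hυ hc0 hOL ω k v v')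
    (by simpa only [Finset.sum_const, Finset.card_univ, nsmul_eq_mul] using hpos) hr
  simpa only [Finset.sum_const, Finset.card_univ, nsmul_eq_mul] using h

/-- **THE ACTION OF A FLOW SAMPLE SELF-AVERAGES**: `Var_π̄(S∘Φ_{0→c}) ≤ |Λ|·(4|κ|υ·e^{Kc})²/4` for the
E–S action (`ℓ¹`-Lipschitz with `L = 2|κ|υ`) — the action of an exactly LO-flowed uniform
configuration fluctuates like `√|Λ|`, its density like `1/√|Λ|`. -/
theorem variance_action_comp_loFlow_le (hU0 : ∀ n, U n n = 0)
    (hUadj : ∀ m n (v w : E), ⟪U m n v, w⟫ = ⟪v, U n m w⟫) (hd : 2 ≤ Module.finrank ℝ E)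
    (κ S₀ : ℝ) {υ : ℝ} (hυ : ∀ k, ∑ m, ‖U k m‖ ≤ υ) {c : ℝ} (hc0 : 0 ≤ c) :
    ∫ ω, (esAction κ S₀ U (sphereTDFlow (G := fun _ : ℝ => loFlowAction κ S₀ U)
          (contDiff_const_family (contDiff_loFlowAction U κ S₀)) T 0 c
            (fun m => ((ω : Λ → sphere (0 : E) 1) m : E))) -
        ∫ ω', esAction κ S₀ U (sphereTDFlow (G := fun _ : ℝ => loFlowAction κ S₀ U)
          (contDiff_const_family (contDiff_loFlowAction U κ S₀)) T 0 c
            (fun m => ((ω' : Λ → sphere (0 : E) 1) m : E)))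
          ∂Measure.pi (fun _ : Λ => uniformSphere (volume : Measure E))) ^ 2
        ∂Measure.pi (fun _ : Λ => uniformSphere (volume : Measure E)) ≤
      Fintype.card Λ * (2 * (2 * |κ| * υ) *
        Real.exp (3 * |κ| * υ / ((Module.finrank ℝ E : ℝ) - 1) * c)) ^ 2 / 4 :=
  variance_flowedObs_le hU0 hUadj hd κ S₀ hυ hc0 (contDiff_esAction U κ S₀ (m := 0)).continuous
    (fun _ _ hx hy => abs_esAction_sub_le hUadj κ S₀ hυ hx hy) (T := T)

/-- **TAIL OF THE ACTION OF A FLOW SAMPLE**: for `0 ≤ c`, `r ≥ 0` (nonempty lattice, `κυ ≠ 0`),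
`π̄{S∘Φ_{0→c} − E ≥ r} ≤ exp(−2r²/(|Λ|·(4|κ|υ·e^{Kc})²))`. -/
theorem measureReal_action_comp_loFlow_ge_le (hU0 : ∀ n, U n n = 0)
    (hUadj : ∀ m n (v w : E), ⟪U m n v, w⟫ = ⟪v, U n m w⟫) (hd : 2 ≤ Module.finrank ℝ E)
    (κ S₀ : ℝ) {υ : ℝ} (hυ : ∀ k, ∑ m, ‖U k m‖ ≤ υ) {c : ℝ} (hc0 : 0 ≤ c)
    (hpos : 0 < Fintype.card Λ * (2 * (2 * |κ| * υ) *
      Real.exp (3 * |κ| * υ / ((Module.finrank ℝ E : ℝ) - 1) * c)) ^ 2) {r : ℝ} (hr : 0 ≤ r) :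
    (Measure.pi (fun _ : Λ => uniformSphere (volume : Measure E))).real
        {ω : Λ → sphere (0 : E) 1 | r ≤
          esAction κ S₀ U (sphereTDFlow (G := fun _ : ℝ => loFlowAction κ S₀ U)
              (contDiff_const_family (contDiff_loFlowAction U κ S₀)) T 0 c (fun m => (ω m : E))) -
            ∫ ω', esAction κ S₀ U (sphereTDFlow (G := fun _ : ℝ => loFlowAction κ S₀ U)
              (contDiff_const_family (contDiff_loFlowAction U κ S₀)) T 0 c
                (fun m => ((ω' : Λ → sphere (0 : E) 1) m : E)))
              ∂Measure.pi (fun _ : Λ => uniformSphere (volume : Measure E))} ≤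
      Real.exp (-(2 * r ^ 2 / (Fintype.card Λ * (2 * (2 * |κ| * υ) *
        Real.exp (3 * |κ| * υ / ((Module.finrank ℝ E : ℝ) - 1) * c)) ^ 2))) :=
  measureReal_flowedObs_ge_le hU0 hUadj hd κ S₀ hυ hc0 (contDiff_esAction U κ S₀ (m := 0)).continuous
    (fun _ _ hx hy => abs_esAction_sub_le hUadj κ S₀ hυ hx hy) hpos hr (T := T)

end Laws

end Summit.Ventures.LatticeQCDFlow.Exactness

end
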